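import Literature.Computability.Complexity.ExtMonotoneGates
import Mathlib.RingTheory.MvPolynomial.Homogeneous

/-!
# Route ConvexRankGates, crux `LinAlgGateBlind` (stmt-PneNP-10681): facet count for linear pencils, I — kernel vectors and specialisation

Support lemmas for the crux (vocabulary of `Theorems/ConvexRankGatesLinAlgGateBlindDefs.lean`). This is the first
file of the FACET COUNT for linear matrix pencils: for matrices `K₁, …, Kₙ ∈ F^{d×d}` over a field and a coordinate
set `W`, put `M_W := ∑_{i ∈ W} Xᵢ Kᵢ ∈ F[X]^{d×d}`; the sets `W` with `det M_W = 0` form a down-set, and the number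
of its maximal members (FACETS) is at most `(d (n+1))^{2d}` — which, through the facet cover `sgAt_of_facet_budget`,
moves the general `GRANK_s` door of the crux from gate parameter `m^{7/16}` to the union-bound limit `m^{7/8}`.
This file supplies the elementary, characteristic-free ingredients:

* `mulVec_cramerVec` / `mulVec_cramerVec_eq_zero` — **Cramer kernel vectors**: for rows `ρ : Fin r → Fin d` and
  columns `γ : Fin (r+1) → Fin d`, the vector `u_b := ∑_{k : γ k = b} (-1)^k det M[ρ, γ ∘ succAbove k]` satisfies
  `(M u)_a = det M[a ∷ ρ, γ]` (Laplace expansion along the first row), hence `M u = 0` as soon as every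
  `(r+1) × (r+1)` minor of `M` vanishes — over any commutative ring; `map_cramerVec`: ring homomorphisms act
  entrywise;
* `pencil_map_kill` — **specialisation**: killing the variables outside `S` (`Xᵢ ↦ Xᵢ` for `i ∈ S`, `Xᵢ ↦ 0`
  otherwise) sends `M_D` to `M_{D ∩ S}`;
* `kill_monomial`, `coeff_kill`, `kill_ne_zero_of_mem_support` — the same substitution keeps exactly the monomials
  supported inside `S`;
* `isHomogeneous_det_submatrix_pencil` — every `κ × κ` minor of `M_D` is homogeneous of degree `#κ`, so a monomial of
  a non-zero `r × r` minor has at most `r` variables (`card_support_le_of_mem_support_det`).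

Sources: Laplace expansion and Cramer's rule [folklore]; Edmonds 1967 §5 (generic matrices). No new definitions.
[folklore]
-/

-- `Summit.PneNP.PneNP.…` duplicates `PneNP` BY DESIGN (single-problem summit).
set_option linter.dupNamespace false

namespace Summit.PneNP.PneNP.Theorems

open Finset Matrix MvPolynomial

/-! ### Cramer kernel vectors -/

section Cramer

variable {A B : Type*} [CommRing A] [CommRing B] {d r : ℕ}

/-- **Laplace expansion of the Cramer vector.** For `M ∈ A^{d×d}`, rows `ρ : Fin r → Fin d` and columns
`γ : Fin (r+1) → Fin d`, the vector `u_b := ∑_{k : γ k = b} (-1)^k · det M[ρ, γ ∘ succAbove k]` satisfies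
`(M u)_a = det M[a ∷ ρ, γ]` for every row `a` (expansion of that `(r+1) × (r+1)` minor along its first row).
[folklore] -/
theorem mulVec_cramerVec (M : Matrix (Fin d) (Fin d) A) (ρ : Fin r → Fin d) (γ : Fin (r + 1) → Fin d)
    (a : Fin d) :
    (M *ᵥ fun b => ∑ k : Fin (r + 1), if γ k = b then
        (-1 : A) ^ (k : ℕ) * (M.submatrix ρ (γ ∘ Fin.succAbove k)).det else 0) a =
      (M.submatrix (Fin.cons a ρ : Fin (r + 1) → Fin d) γ).det := by
  rw [Matrix.det_succ_row_zero]
  simp only [mulVec, dotProduct, Finset.mul_sum, mul_ite, mul_zero]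
  rw [Finset.sum_comm]
  refine Finset.sum_congr rfl fun k _ => ?_
  rw [Finset.sum_ite_eq univ (γ k), if_pos (mem_univ _)]
  have hsub : (M.submatrix (Fin.cons a ρ : Fin (r + 1) → Fin d) γ).submatrix Fin.succ (Fin.succAbove k) =
      M.submatrix ρ (γ ∘ Fin.succAbove k) := by
    ext p q
    simp [Matrix.submatrix_apply]
  rw [hsub]
  simp only [Matrix.submatrix_apply, Fin.cons_zero]
  ring

/-- **Cramer kernel vectors.** If every `(r+1) × (r+1)` minor of `M ∈ A^{d×d}` vanishes then the Cramer vector of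
`mulVec_cramerVec` lies in the kernel of `M` — for every choice of `r` rows and `r+1` columns, over any commutative
ring. [folklore] -/
theorem mulVec_cramerVec_eq_zero : ∀ {A : Type*} [CommRing A] {d r : ℕ} (M : Matrix (Fin d) (Fin d) A)
    (ρ : Fin r → Fin d) (γ : Fin (r + 1) → Fin d),
    (∀ (ρ' γ' : Fin (r + 1) → Fin d), (M.submatrix ρ' γ').det = 0) →
    (M *ᵥ fun b => ∑ k : Fin (r + 1), if γ k = b then
        (-1 : A) ^ (k : ℕ) * (M.submatrix ρ (γ ∘ Fin.succAbove k)).det else 0) = 0 := by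
  intro A _ d r M ρ γ h
  funext a
  rw [mulVec_cramerVec, Pi.zero_apply]
  exact h _ _

/-- Ring homomorphisms act on Cramer vectors entrywise. [folklore] -/
theorem map_cramerVec (f : A →+* B) (M : Matrix (Fin d) (Fin d) A) (ρ : Fin r → Fin d)
    (γ : Fin (r + 1) → Fin d) (b : Fin d) :
    f (∑ k : Fin (r + 1), if γ k = b then
        (-1 : A) ^ (k : ℕ) * (M.submatrix ρ (γ ∘ Fin.succAbove k)).det else 0) =
      ∑ k : Fin (r + 1), if γ k = b then
        (-1 : B) ^ (k : ℕ) * ((M.map f).submatrix ρ (γ ∘ Fin.succAbove k)).det else 0 := by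
  rw [map_sum]
  refine Finset.sum_congr rfl fun k _ => ?_
  split_ifs
  · rw [map_mul, map_pow, map_neg, map_one, RingHom.map_det, Matrix.submatrix_map]
    rfl
  · exact map_zero f

/-- The entry of the Cramer vector at a column `γ 0` not hit again by `γ ∘ succ` is the leading minor
`det M[ρ, γ ∘ succ]`. [folklore] -/
theorem cramerVec_apply_head (M : Matrix (Fin d) (Fin d) A) (ρ : Fin r → Fin d) (γ : Fin (r + 1) → Fin d)
    (hγ : ∀ k : Fin r, γ k.succ ≠ γ 0) :
    (∑ k : Fin (r + 1), if γ k = γ 0 then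
        (-1 : A) ^ (k : ℕ) * (M.submatrix ρ (γ ∘ Fin.succAbove k)).det else 0) =
      (M.submatrix ρ (γ ∘ Fin.succ)).det := by
  rw [Fin.sum_univ_succ, if_pos rfl]
  have hrest : ∑ k : Fin r, (if γ k.succ = γ 0 then
      (-1 : A) ^ ((k.succ : Fin (r + 1)) : ℕ) * (M.submatrix ρ (γ ∘ Fin.succAbove k.succ)).det else 0) = 0 :=
    Finset.sum_eq_zero fun k _ => if_neg (hγ k)
  rw [hrest, add_zero]
  simp

end Cramer

/-! ### Specialisation of linear pencils: killing variables -/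

section Kill

variable {F : Type*} [Field F] {ι : Type*} [DecidableEq ι] {d : ℕ}

/-- **Specialising a pencil.** Killing the variables outside `S` (`Xᵢ ↦ Xᵢ` for `i ∈ S`, `Xᵢ ↦ 0` otherwise) maps the
pencil `∑_{i ∈ D} Xᵢ Kᵢ` to the sub-pencil `∑_{i ∈ D ∩ S} Xᵢ Kᵢ`. [folklore] -/
theorem pencil_map_kill (K : ι → Matrix (Fin d) (Fin d) F) (D S : Finset ι) :
    (∑ i ∈ D, (X i : MvPolynomial ι F) • (K i).map (C : F →+* MvPolynomial ι F)).map
        (MvPolynomial.aeval (R := F) fun i => if i ∈ S then (X i : MvPolynomial ι F) else 0) =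
      ∑ i ∈ D ∩ S, (X i : MvPolynomial ι F) • (K i).map (C : F →+* MvPolynomial ι F) := by
  ext a b
  simp only [Matrix.map_apply, Matrix.sum_apply, Matrix.smul_apply, smul_eq_mul, map_sum, map_mul,
    MvPolynomial.aeval_X, MvPolynomial.algHom_C, MvPolynomial.algebraMap_eq, ite_mul, zero_mul]
  rw [← Finset.sum_filter, Finset.filter_mem_eq_inter]

/-- Killing the variables outside `S ⊇ D` does not change the pencil of `D`. [folklore] -/
theorem pencil_map_kill_of_subset (K : ι → Matrix (Fin d) (Fin d) F) {D S : Finset ι} (h : D ⊆ S) :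
    (∑ i ∈ D, (X i : MvPolynomial ι F) • (K i).map (C : F →+* MvPolynomial ι F)).map
        (MvPolynomial.aeval (R := F) fun i => if i ∈ S then (X i : MvPolynomial ι F) else 0) =
      ∑ i ∈ D, (X i : MvPolynomial ι F) • (K i).map (C : F →+* MvPolynomial ι F) := by
  rw [pencil_map_kill, Finset.inter_eq_left.2 h]

/-- Killing the variables outside `S ⊆ D` maps the pencil of `D` to the pencil of `S`. [folklore] -/
theorem pencil_map_kill_of_superset (K : ι → Matrix (Fin d) (Fin d) F) {D S : Finset ι} (h : S ⊆ D) :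
    (∑ i ∈ D, (X i : MvPolynomial ι F) • (K i).map (C : F →+* MvPolynomial ι F)).map
        (MvPolynomial.aeval (R := F) fun i => if i ∈ S then (X i : MvPolynomial ι F) else 0) =
      ∑ i ∈ S, (X i : MvPolynomial ι F) • (K i).map (C : F →+* MvPolynomial ι F) := by
  rw [pencil_map_kill, Finset.inter_eq_right.2 h]

/-- The kill substitution on a monomial: it survives iff all its variables lie in `S`. [folklore] -/
theorem kill_monomial (S : Finset ι) (β : ι →₀ ℕ) (c : F) :
    MvPolynomial.aeval (R := F) (fun i => if i ∈ S then (X i : MvPolynomial ι F) else 0) (monomial β c) =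
      if β.support ⊆ S then monomial β c else 0 := by
  rw [MvPolynomial.aeval_monomial, MvPolynomial.algebraMap_eq]
  by_cases hβ : β.support ⊆ S
  · rw [if_pos hβ, MvPolynomial.monomial_eq]
    congr 1
    refine Finsupp.prod_congr fun i hi => ?_
    rw [if_pos (hβ hi)]
  · rw [if_neg hβ]
    obtain ⟨i, hi, hiS⟩ := Finset.not_subset.1 hβ
    have h0 : (β.prod fun j e => (if j ∈ S then (X j : MvPolynomial ι F) else 0) ^ e) = 0 := by
      rw [Finsupp.prod, Finset.prod_eq_zero hi]
      rw [if_neg hiS, zero_pow (Finsupp.mem_support_iff.1 hi)]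
    rw [h0, mul_zero]

/-- Coefficients after killing the variables outside `S`: the monomials supported inside `S` keep their
coefficient, all others disappear. [folklore] -/
theorem coeff_kill (S : Finset ι) (P : MvPolynomial ι F) (α : ι →₀ ℕ) :
    coeff α (MvPolynomial.aeval (R := F) (fun i => if i ∈ S then (X i : MvPolynomial ι F) else 0) P) =
      if α.support ⊆ S then coeff α P else 0 := by
  conv_lhs => rw [MvPolynomial.as_sum P]
  rw [map_sum, MvPolynomial.coeff_sum]
  simp only [kill_monomial, apply_ite (coeff α), MvPolynomial.coeff_monomial, MvPolynomial.coeff_zero]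
  by_cases hα : α.support ⊆ S
  · rw [if_pos hα]
    by_cases hmem : α ∈ P.support
    · rw [Finset.sum_eq_single α]
      · simp [hα]
      · intro β _ hβα
        rw [if_neg hβα, ite_self]
      · intro h
        exact absurd hmem h
    · rw [MvPolynomial.notMem_support_iff.1 hmem]
      refine Finset.sum_eq_zero fun β hβ => ?_
      have hβα : β ≠ α := fun h => hmem (h ▸ hβ)
      rw [if_neg hβα, ite_self]
  · rw [if_neg hα]
    refine Finset.sum_eq_zero fun β _ => ?_
    by_cases hβS : β.support ⊆ S
    · rw [if_pos hβS]
      have hβα : β ≠ α := fun h => hα (h ▸ hβS)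
      rw [if_neg hβα]
    · rw [if_neg hβS]

/-- A polynomial with a monomial supported inside `S` survives killing the variables outside `S`. [folklore] -/
theorem kill_ne_zero_of_mem_support (S : Finset ι) (P : MvPolynomial ι F) {α : ι →₀ ℕ}
    (hα : α ∈ P.support) (hαS : α.support ⊆ S) :
    MvPolynomial.aeval (R := F) (fun i => if i ∈ S then (X i : MvPolynomial ι F) else 0) P ≠ 0 := by
  intro h
  have hc := coeff_kill S P α
  rw [h, MvPolynomial.coeff_zero, if_pos hαS] at hc
  exact (MvPolynomial.mem_support_iff.1 hα) hc.symm

/-- The monomials surviving the kill substitution are supported inside `S`. [folklore] -/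
theorem support_subset_of_mem_support_kill (S : Finset ι) (P : MvPolynomial ι F) {α : ι →₀ ℕ}
    (hα : α ∈ (MvPolynomial.aeval (R := F)
      (fun i => if i ∈ S then (X i : MvPolynomial ι F) else 0) P).support) :
    α.support ⊆ S := by
  by_contra h
  have hc := coeff_kill S P α
  rw [if_neg h] at hc
  exact (MvPolynomial.mem_support_iff.1 hα) hc

/-! ### Minors of a linear pencil are homogeneous -/

omit [DecidableEq ι] in
/-- Every `κ × κ` minor of the pencil `∑_{i ∈ D} Xᵢ Kᵢ` is homogeneous of degree `#κ` (its entries are linear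
forms). [folklore] -/
theorem isHomogeneous_det_submatrix_pencil (K : ι → Matrix (Fin d) (Fin d) F) (D : Finset ι)
    {κ : Type*} [Fintype κ] [DecidableEq κ] (ρ γ : κ → Fin d) :
    ((∑ i ∈ D, (X i : MvPolynomial ι F) • (K i).map (C : F →+* MvPolynomial ι F)).submatrix ρ γ).det.IsHomogeneous
      (Fintype.card κ) := by
  have aux : Fintype.card κ = 0 + ∑ _p : κ, 1 := by simp
  rw [Matrix.det_apply', aux]
  refine IsHomogeneous.sum _ _ _ fun σ _ => IsHomogeneous.mul ?_ ?_
  · exact isHomogeneous_C _ _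
  · refine IsHomogeneous.prod _ _ _ fun p _ => ?_
    simp only [Matrix.submatrix_apply, Matrix.sum_apply, Matrix.smul_apply, Matrix.map_apply, smul_eq_mul]
    refine IsHomogeneous.sum _ _ _ fun i _ => ?_
    simpa using (isHomogeneous_X F i).mul (isHomogeneous_C ι (K i (ρ (σ p)) (γ p)))

omit [DecidableEq ι] in
/-- A monomial of a `κ × κ` minor of a linear pencil has at most `#κ` variables. [folklore] -/
theorem card_support_le_of_mem_support_det (K : ι → Matrix (Fin d) (Fin d) F) (D : Finset ι)
    {κ : Type*} [Fintype κ] [DecidableEq κ] (ρ γ : κ → Fin d) {α : ι →₀ ℕ}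
    (hα : α ∈ ((∑ i ∈ D, (X i : MvPolynomial ι F) • (K i).map (C : F →+* MvPolynomial ι F)).submatrix ρ γ).det.support) :
    #α.support ≤ Fintype.card κ := by
  have hdeg := (isHomogeneous_det_submatrix_pencil K D ρ γ) (MvPolynomial.mem_support_iff.1 hα)
  -- `weight 1 α = ∑ i, α i ≥ #support α`
  rw [Finsupp.weight_apply] at hdeg
  simp only [Pi.one_apply, smul_eq_mul, mul_one] at hdeg
  rw [← hdeg, Finsupp.sum, Finset.card_eq_sum_ones]
  exact Finset.sum_le_sum fun i hi => Nat.one_le_iff_ne_zero.2 (Finsupp.mem_support_iff.1 hi)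

end Kill

end Summit.PneNP.PneNP.Theorems
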